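import Summits.BirchSwinnertonDyer.BirchSwinnertonDyer.Theorems.Rank2ObservatoryPadicRow
import HarnessLib

/-!
# BirchSwinnertonDyer — rank ≥ 2 observatory: the `p`-adic `L`-datum from a modular-symbol table

HONEST FRAMING: per-curve certified theorems and census instruments; no claim on BSD in rank ≥ 2.

Module of the series `Rank2ObservatoryPadic*.lean` (generic squeeze: `Rank2ObservatoryPadicRow.lean`).
It turns the engines' `L`-side INPUT — a table of rational plus modular symbols — into the hypothesis
`hLp : [T^r] L_p ≠ 0` of the `p`-adic row by a KERNEL computation of the level-`p²` Riemann sum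
(`teichSet`, `finsum_rootsOfUnity_eq_sum_teichSet`, `isum`, `padicLRiemannSum_one_eq`,
`norm_msdMeasure_le_one`, `coeff_ne_zero_of_symbolTable`), records the decidable side conditions at
`p ∈ {5, 7, 11, 13}` (`teichSet_card_*`, `teich_unit_*`), and the generic "good ORDINARY reduction from a
kernel point count" step `isOrdinaryAt_baseChange_int_of_card` used by every machine-written cell. The
general measure level `p^{n+1}` (unit-root digits) is `Rank2ObservatoryPadicSymbolTableL.lean`; the cells
are `Rank2ObservatoryPadicSymbolCells389a1.lean`, `…5077a1.lean` and the atlas `Rank2ObservatoryPadicAtlas*.lean`.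

## The `L`-datum from a modular-symbol table: the level-`p²` Riemann sum, kernel-checked

The engines' `L`-side input is a table of rational plus modular symbols. This section makes the
step "table ⟹ `[T^r] L_p ≠ 0`" a KERNEL computation: for odd `p`, the tree's Riemann sum
`RS(r, 1) = Σ_ζ Σ_{s mod p} μ_{f,α}(ζ γ^s + p² ℤ_p) · C(s, r)` (`padicLRiemannSum f α r 1`,
`γ = 1 + p`, `ζ` over the Teichmüller representatives) is rewritten as
`α⁻² · ΣHi/D − α⁻³ · ΣLo/D` with two INTEGER double sums over the tabulated numerators
(`padicLRiemannSum_one_eq`; the reindexing `rootsOfUnity τ ℤ_p ≃ {y mod p² : y^τ = 1}` is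
`finsum_rootsOfUnity_eq_sum_teichSet`, from the tree's `toZModPow_rootsOfUnity_injective` and
`card_rootsOfUnity_torsionOrder` plus a decidable count), the sums are evaluated by `decide`, and
`‖RS(r, 1)‖ = 1 > p⁻¹ = (C/‖r!‖_p) p^{-1}` (`C = 1` from `p`-integrality of the symbols,
`norm_msdMeasure_le_one`) is exactly the certificate inequality of
`coeff_ne_zero_of_riemannSum_certificate`. For all eight two-engine cells
`{389a1, 5077a1} × {5, 7, 11, 13}` the level-`p²` table already certifies the leading coefficient:
`ΣLo = 0` (it is `C(p, r+1) · Σ_{a mod p} [a/p]⁺`, and `[0]⁺ = L(E,1)/Ω = 0`) and `p ∤ ΣHi`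
(`[T^r] L_p` is a unit: `v = 0` in `DIFF_R2A.tsv` / `DIFF_R3A.tsv`, column `Tcoef_digits`).
DATA hypotheses of the cell theorems `padicRow_<label>_<p>_of_symbolTable`: `hint` — every plus
symbol `[x]⁺_f` is `p`-integral (denominator `2` for both curves: engine A `common_denominator = 2`
at every computed level, eclib); `htab` — the `2(p² − p)` tabulated numerators ARE `D·[u/p²]⁺_f`,
`D·[u/p]⁺_f` at the unit residues `u mod p²`, for some rational `D` with `‖D‖_p = 1` (`D = 2` in
the period convention `Ω⁺_f = Ω_E = c_∞ ω₁` shared by the tree (item C9) and engine A; any `p`-unit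
rescaling of the period is absorbed by `D`). Tables: engine A bundle jobA6 (`msengine`, numerical
period integrals rounded with Hecke-relation checks `symbols_ok`), file `symcert/symtab.json` of the
seat folder; cross-check: `α⁻² ΣHi/2 mod p` reproduces engine A's `[T^r] P_2` digit in all 8 cells.
[cite: MazurTateTeitelbaum1986Invent, §I.10–I.13] [cite: SteinWuthrich2013, §3]
-/

-- single-conjunct summit: `Summit.BirchSwinnertonDyer.BirchSwinnertonDyer.…` repeats the name by design
set_option linter.dupNamespace false

noncomputable section

open scoped Classical

namespace Summit.BirchSwinnertonDyer.BirchSwinnertonDyer.Rank2Observatory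

open scoped MatrixGroups ModularForm
open CongruenceSubgroup Literature.NumberTheory.EllipticCurves
  Literature.NumberTheory.EllipticCurves.ModularForms WeierstrassCurve

/-- `5` is prime (cells at `p = 5`). [folklore] -/
instance fact_prime_five : Fact (Nat.Prime 5) := ⟨by norm_num⟩

/-- `7` is prime (cells at `p = 7`). [folklore] -/
instance fact_prime_seven : Fact (Nat.Prime 7) := ⟨by norm_num⟩

/-- `11` is prime (cells at `p = 11`). [folklore] -/
instance fact_prime_eleven : Fact (Nat.Prime 11) := ⟨by norm_num⟩

/-- `13` is prime (cells at `p = 13`). [folklore] -/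
instance fact_prime_thirteen : Fact (Nat.Prime 13) := ⟨by norm_num⟩

section SymbolTable

variable (p : ℕ) [Fact p.Prime]

/-- Teichmüller residues modulo `p^m`: the solutions of `y^τ = 1` in `ℤ/p^m`, `τ = torsionOrder p`
(the reductions of `rootsOfUnity τ ℤ_p`; Washington §5.1). [cite: MazurTateTeitelbaum1986Invent, §I.13] -/
def teichSet (m : ℕ) : Finset (ZMod (p ^ m)) :=
  Finset.univ.filter (fun y => y ^ torsionOrder p = 1)

/-- **Reindexing the Teichmüller sum.** For `m ≥ e₀`, a sum over `rootsOfUnity τ ℤ_p` of a function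
of the residue modulo `p^m` is the sum over `teichSet p m`, granted the (decidable) count
`#teichSet p m = τ`: the reduction is injective (`toZModPow_rootsOfUnity_injective`, after casting
down to level `p^{e₀}`), lands in `teichSet`, and both sides have `τ` elements
(`card_rootsOfUnity_torsionOrder`). [cite: MazurTateTeitelbaum1986Invent, §I.13] -/
theorem finsum_rootsOfUnity_eq_sum_teichSet {M : Type*} [AddCommMonoid M] (m : ℕ)
    (hm : cyclotomicExponent p ≤ m) (hcard : (teichSet p m).card = torsionOrder p)
    (F : ZMod (p ^ m) → M) :
    ∑ᶠ ζ : rootsOfUnity (torsionOrder p) ℤ_[p], F (PadicInt.toZModPow m ((ζ : ℤ_[p]ˣ) : ℤ_[p])) =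
      ∑ y ∈ teichSet p m, F y := by
  classical
  haveI := neZero_torsionOrder p
  haveI : Fintype (rootsOfUnity (torsionOrder p) ℤ_[p]) := Fintype.ofFinite _
  set g : rootsOfUnity (torsionOrder p) ℤ_[p] → ZMod (p ^ m) :=
    fun ζ => PadicInt.toZModPow m ((ζ : ℤ_[p]ˣ) : ℤ_[p]) with hg
  have hinj : Function.Injective g := by
    intro ζ ζ' h
    apply toZModPow_rootsOfUnity_injective p
    have h' := congr_arg (ZMod.castHom (pow_dvd_pow p hm) (ZMod (p ^ cyclotomicExponent p))) h
    simpa only [hg, ZMod.castHom_apply, PadicInt.cast_toZModPow _ _ hm] using h'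
  have himage : Finset.univ.image g = teichSet p m := by
    apply Finset.eq_of_subset_of_card_le
    · intro y hy
      obtain ⟨ζ, -, rfl⟩ := Finset.mem_image.mp hy
      simp only [teichSet, Finset.mem_filter, Finset.mem_univ, true_and, hg]
      rw [← map_pow, rootsOfUnity_pow_torsionOrder, map_one]
    · rw [Finset.card_image_of_injective _ hinj, Finset.card_univ, ← Nat.card_eq_fintype_card,
        card_rootsOfUnity_torsionOrder, hcard]
  rw [finsum_eq_sum_of_fintype, ← himage, Finset.sum_image fun x _ y _ h => hinj h]

/-- The INTEGER double sum `Σ_{y ∈ teichSet p m} Σ_{s mod p} tab[(y (1+p)^s mod p^m)] · C(s, k)` over a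
table of numerators (computable; evaluated by `decide`). [folklore] -/
def isum (m : ℕ) (tab : List ℤ) (k : ℕ) : ℤ :=
  ∑ y ∈ teichSet p m, ∑ s : ZMod (p ^ 1),
    tab.getD ((y * ((1 + p : ℕ) : ZMod (p ^ m)) ^ s.val).val) 0 * (s.val.choose k : ℤ)

/-- **The level-`p²` Riemann sum from a plus-symbol table** (odd `p`). If the rational plus symbols
at the unit residues `u mod p²` are `[u/p²]⁺ = tabHi[u]/D` and `[u/p]⁺ = tabLo[u]/D`, then
`RS(k, 1) = α⁻² · isum(tabHi)/D − α⁻³ · isum(tabLo)/D` (definition (10.1) of `μ_{f,α}` at level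
`p² = p^{1+e₀}`, `γ = 1 + p`, reindexed by `finsum_rootsOfUnity_eq_sum_teichSet`; `hunit`: every
class `y γ^s` is a unit residue, decidable). [cite: MazurTateTeitelbaum1986Invent, §I.10 (10.1), §I.13] -/
theorem padicLRiemannSum_one_eq {N : ℕ} (f : CuspForm (Gamma0 N) 2) (α : ℚ_[p]) (k : ℕ)
    (hp2 : p ≠ 2) (tabHi tabLo : List ℤ) (D : ℚ)
    (hcard : (teichSet p 2).card = torsionOrder p)
    (hunit : ∀ y ∈ teichSet p 2, ∀ s : ZMod (p ^ 1),
      ¬ p ∣ (y * ((1 + p : ℕ) : ZMod (p ^ 2)) ^ s.val).val)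
    (htab : ∀ u : ℕ, u < p ^ 2 → ¬ p ∣ u →
      ratPlusSymbol f ((u : ℚ) / (p : ℚ) ^ 2) = (tabHi.getD u 0 : ℚ) / D ∧
      ratPlusSymbol f ((u : ℚ) / (p : ℚ) ^ 1) = (tabLo.getD u 0 : ℚ) / D) :
    padicLRiemannSum f α k 1 =
      α⁻¹ ^ 2 * ((((isum p 2 tabHi k : ℤ) : ℚ) / D : ℚ) : ℚ_[p]) -
        α⁻¹ ^ 3 * ((((isum p 2 tabLo k : ℤ) : ℚ) / D : ℚ) : ℚ_[p]) := by
  have he : cyclotomicExponent p = 1 := if_neg hp2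
  have hγ : cyclotomicGenerator p = 1 + p := by simp [cyclotomicGenerator, he]
  unfold padicLRiemannSum
  rw [hγ]
  generalize hm : 1 + cyclotomicExponent p = m
  obtain rfl : m = 2 := by omega
  rw [finsum_rootsOfUnity_eq_sum_teichSet p 2 (by omega) hcard
    (fun y => ∑ s : ZMod (p ^ 1), msdMeasure f α 2 (y * ((1 + p : ℕ) : ZMod (p ^ 2)) ^ s.val) *
      (s.val.choose k : ℚ_[p]))]
  have hval : ∀ y ∈ teichSet p 2, ∀ s : ZMod (p ^ 1),
      msdMeasure f α 2 (y * ((1 + p : ℕ) : ZMod (p ^ 2)) ^ s.val) =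
        α⁻¹ ^ 2 * (((tabHi.getD ((y * ((1 + p : ℕ) : ZMod (p ^ 2)) ^ s.val).val) 0 : ℚ) / D : ℚ) :
            ℚ_[p]) -
          α⁻¹ ^ 3 * (((tabLo.getD ((y * ((1 + p : ℕ) : ZMod (p ^ 2)) ^ s.val).val) 0 : ℚ) / D : ℚ) :
            ℚ_[p]) := by
    intro y hy s
    set u := y * ((1 + p : ℕ) : ZMod (p ^ 2)) ^ s.val with hu
    obtain ⟨h2, h1⟩ := htab u.val (ZMod.val_lt u) (hunit y hy s)
    show α⁻¹ ^ 2 * (ratPlusSymbol f ((u.val : ℚ) / (p : ℚ) ^ 2) : ℚ_[p]) -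
      α⁻¹ ^ 3 * (ratPlusSymbol f ((u.val : ℚ) / (p : ℚ) ^ 1) : ℚ_[p]) = _
    rw [h2, h1]
  rw [Finset.sum_congr rfl fun y hy => Finset.sum_congr rfl fun s _ => by rw [hval y hy s]]
  have hR : ∀ tab : List ℤ,
      (∑ y ∈ teichSet p 2, ∑ s : ZMod (p ^ 1),
        (((tab.getD ((y * ((1 + p : ℕ) : ZMod (p ^ 2)) ^ s.val).val) 0 : ℚ) / D : ℚ) : ℚ_[p]) *
          (s.val.choose k : ℚ_[p])) = ((((isum p 2 tab k : ℤ) : ℚ) / D : ℚ) : ℚ_[p]) := by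
    intro tab
    simp only [isum]
    push_cast
    rw [Finset.sum_div]
    refine Finset.sum_congr rfl fun y _ => ?_
    rw [Finset.sum_div]
    refine Finset.sum_congr rfl fun s _ => ?_
    ring
  simp only [sub_mul, Finset.sum_sub_distrib, mul_assoc, ← Finset.mul_sum, hR]

/-- Norm of the certified shape: `‖α⁻² · H/D − α⁻³ · 0/D‖ = 1` for `‖α‖ = 1`, `‖D‖_p = 1` and an
integer `H` prime to `p`. [folklore] -/
theorem norm_cert_eq_one (α : ℚ_[p]) (hα : ‖α‖ = 1) (D : ℚ) (hD : ‖(D : ℚ_[p])‖ = 1) (H : ℤ)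
    (hH : ¬ (p : ℤ) ∣ H) :
    ‖α⁻¹ ^ 2 * ((((H : ℤ) : ℚ) / D : ℚ) : ℚ_[p]) -
      α⁻¹ ^ 3 * (((((0 : ℤ) : ℤ) : ℚ) / D : ℚ) : ℚ_[p])‖ = 1 := by
  rw [Int.cast_zero, zero_div, Rat.cast_zero, mul_zero, sub_zero, norm_mul, norm_pow, norm_inv, hα,
    inv_one, one_pow, one_mul, Rat.cast_div, norm_div, hD, div_one, Rat.cast_intCast]
  have hle := Padic.norm_int_le_one (p := p) H
  have hlt : ¬ ‖(H : ℚ_[p])‖ < 1 := by rwa [Padic.norm_intCast_lt_one_iff]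
  exact le_antisymm hle (not_lt.mp hlt)

/-- **Measure bound from symbol integrality**: if every plus symbol `[x]⁺_f` is `p`-integral and
`‖α‖ = 1` then `‖μ_{f,α}(a + p^m ℤ_p)‖ ≤ 1` for all `m, a` (definition (10.1), ultrametric
inequality). [cite: MazurTateTeitelbaum1986Invent, §I.10 (10.1)] -/
theorem norm_msdMeasure_le_one {N : ℕ} (f : CuspForm (Gamma0 N) 2) (α : ℚ_[p]) (hα : ‖α‖ = 1)
    (hint : ∀ x : ℚ, ‖(ratPlusSymbol f x : ℚ_[p])‖ ≤ 1) (m : ℕ) (a : ZMod (p ^ m)) :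
    ‖msdMeasure f α m a‖ ≤ 1 := by
  have hαi : ‖α⁻¹‖ = 1 := by rw [norm_inv, hα, inv_one]
  cases m with
  | zero =>
    show ‖(1 - α⁻¹) * (ratPlusSymbol f 0 : ℚ_[p])‖ ≤ 1
    rw [norm_mul]
    have h1 : ‖(1 : ℚ_[p]) - α⁻¹‖ ≤ 1 := by
      rw [sub_eq_add_neg]
      refine (Padic.nonarchimedean _ _).trans ?_
      rw [norm_one, norm_neg, hαi, max_self]
    calc ‖(1 : ℚ_[p]) - α⁻¹‖ * ‖(ratPlusSymbol f 0 : ℚ_[p])‖ ≤ 1 * 1 :=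
          mul_le_mul h1 (hint 0) (norm_nonneg _) zero_le_one
      _ = 1 := one_mul 1
  | succ n =>
    show ‖α⁻¹ ^ (n + 1) * (ratPlusSymbol f ((a.val : ℚ) / (p : ℚ) ^ (n + 1)) : ℚ_[p]) -
      α⁻¹ ^ (n + 2) * (ratPlusSymbol f ((a.val : ℚ) / (p : ℚ) ^ n) : ℚ_[p])‖ ≤ 1
    rw [sub_eq_add_neg]
    refine (Padic.nonarchimedean _ _).trans (max_le ?_ ?_)
    · rw [norm_mul, norm_pow, hαi, one_pow, one_mul]; exact hint _
    · rw [norm_neg, norm_mul, norm_pow, hαi, one_pow, one_mul]; exact hint _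

/-- **`[T^r] L_p ≠ 0` from a level-`p²` symbol table** (odd good ordinary `p`, `p ∤ r!`): the
hypotheses of `coeff_ne_zero_of_riemannSum_certificate` with `C = 1`, `n = 1` are discharged by
`norm_msdMeasure_le_one` (symbol integrality `hint`), `padicLRiemannSum_one_eq` (table `htab`,
decidable side conditions `hcard`, `hunit`, integer sums `hHi : isum tabHi = H`, `hLo : isum tabLo = 0`)
and `norm_cert_eq_one` (`p ∤ H`, `‖D‖_p = 1`): then `(1/‖r!‖_p) p⁻¹ = p⁻¹ < 1 = ‖RS(r, 1)‖`.
[cite: MazurTateTeitelbaum1986Invent, §I.10–I.13] [cite: SteinWuthrich2013, §3] -/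
theorem coeff_ne_zero_of_symbolTable (hp2 : p ≠ 2) (W : WeierstrassCurve ℚ) [W.IsElliptic]
    [W.IsGloballyMinimal] {N : ℕ} [NeZero N] {f : CuspForm (Gamma0 N) 2}
    (hord : IsOrdinaryAt W p) (hf : IsNewformOf W f) {r : ℕ} (hr : ¬ p ∣ r.factorial)
    (tabHi tabLo : List ℤ) (D : ℚ) (hD : ‖(D : ℚ_[p])‖ = 1) (H : ℤ) (hH : ¬ (p : ℤ) ∣ H)
    (hcard : (teichSet p 2).card = torsionOrder p)
    (hunit : ∀ y ∈ teichSet p 2, ∀ s : ZMod (p ^ 1),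
      ¬ p ∣ (y * ((1 + p : ℕ) : ZMod (p ^ 2)) ^ s.val).val)
    (hHi : isum p 2 tabHi r = H) (hLo : isum p 2 tabLo r = 0)
    (hint : ∀ x : ℚ, ‖(ratPlusSymbol f x : ℚ_[p])‖ ≤ 1)
    (htab : ∀ u : ℕ, u < p ^ 2 → ¬ p ∣ u →
      ratPlusSymbol f ((u : ℚ) / (p : ℚ) ^ 2) = (tabHi.getD u 0 : ℚ) / D ∧
      ratPlusSymbol f ((u : ℚ) / (p : ℚ) ^ 1) = (tabLo.getD u 0 : ℚ) / D) :
    PowerSeries.coeff r (padicLFunction f (unitRoot W p : ℚ_[p])) ≠ 0 := by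
  have hα : ‖(unitRoot W p : ℚ_[p])‖ = 1 := norm_unitRoot_holds W p hord
  refine coeff_ne_zero_of_riemannSum_certificate W p hord hf (C := 1)
    (norm_msdMeasure_le_one p f _ hα hint) (n := 1) ?_
  rw [padicLRiemannSum_one_eq p f _ r hp2 tabHi tabLo D hcard hunit htab, hHi, hLo,
    norm_cert_eq_one p _ hα D hD H hH]
  have hfac : ‖((r.factorial : ℕ) : ℚ_[p])‖ = 1 := by
    rw [Padic.norm_natCast_eq_one_iff]
    exact (Nat.Prime.coprime_iff_not_dvd Fact.out).mpr hr
  rw [hfac, div_one, one_mul, Nat.cast_one, zpow_neg_one]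
  exact inv_lt_one_of_one_lt₀ (by exact_mod_cast (Fact.out : p.Prime).one_lt)

/-- `‖2‖_p = 1` for the symbol denominator `D = 2` at odd `p`. [folklore] -/
theorem norm_two_eq_one (hp2 : p ≠ 2) : ‖((2 : ℚ) : ℚ_[p])‖ = 1 := by
  rw [show ((2 : ℚ) : ℚ_[p]) = ((2 : ℕ) : ℚ_[p]) by norm_num, Padic.norm_natCast_eq_one_iff]
  exact (Nat.coprime_primes Fact.out Nat.prime_two).mpr hp2


/-- `#teichSet 5 2 = τ(5) = 4` (the 4 solutions of `y^4 = 1` modulo `25`). [folklore] -/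
theorem teichSet_card_5 : (teichSet 5 2).card = torsionOrder 5 := by decide +kernel

/-- Every class `y · 6^s mod 25` (`y ∈ teichSet 5 2`, `s mod 5`) is a unit residue. [folklore] -/
theorem teich_unit_5 : ∀ y ∈ teichSet 5 2, ∀ s : ZMod (5 ^ 1),
    ¬ 5 ∣ (y * ((1 + 5 : ℕ) : ZMod (5 ^ 2)) ^ s.val).val := by decide +kernel

/-- `#teichSet 7 2 = τ(7) = 6` (the 6 solutions of `y^6 = 1` modulo `49`). [folklore] -/
theorem teichSet_card_7 : (teichSet 7 2).card = torsionOrder 7 := by decide +kernel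

/-- Every class `y · 8^s mod 49` (`y ∈ teichSet 7 2`, `s mod 7`) is a unit residue. [folklore] -/
theorem teich_unit_7 : ∀ y ∈ teichSet 7 2, ∀ s : ZMod (7 ^ 1),
    ¬ 7 ∣ (y * ((1 + 7 : ℕ) : ZMod (7 ^ 2)) ^ s.val).val := by decide +kernel

/-- `#teichSet 11 2 = τ(11) = 10` (the 10 solutions of `y^10 = 1` modulo `121`). [folklore] -/
theorem teichSet_card_11 : (teichSet 11 2).card = torsionOrder 11 := by decide +kernel

/-- Every class `y · 12^s mod 121` (`y ∈ teichSet 11 2`, `s mod 11`) is a unit residue. [folklore] -/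
theorem teich_unit_11 : ∀ y ∈ teichSet 11 2, ∀ s : ZMod (11 ^ 1),
    ¬ 11 ∣ (y * ((1 + 11 : ℕ) : ZMod (11 ^ 2)) ^ s.val).val := by decide +kernel

/-- `#teichSet 13 2 = τ(13) = 12` (the 12 solutions of `y^12 = 1` modulo `169`). [folklore] -/
theorem teichSet_card_13 : (teichSet 13 2).card = torsionOrder 13 := by decide +kernel

/-- Every class `y · 14^s mod 169` (`y ∈ teichSet 13 2`, `s mod 13`) is a unit residue. [folklore] -/
theorem teich_unit_13 : ∀ y ∈ teichSet 13 2, ∀ s : ZMod (13 ^ 1),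
    ¬ 13 ∣ (y * ((1 + 13 : ℕ) : ZMod (13 ^ 2)) ^ s.val).val := by decide +kernel

end SymbolTable

section AtlasGeneric

variable (p : ℕ) [Fact p.Prime]

/-- Good ORDINARY reduction of an integer model from a kernel point count: `p ∤ Δ` and
`p ∤ a_p = p + 1 − #Ẽ(𝔽_p)`. [cite: SilvermanAEC2009, VII.1 Remark 1.1] -/
theorem isOrdinaryAt_baseChange_int_of_card (e : WeierstrassCurve ℤ)
    [(e.baseChange ℚ).IsGloballyMinimal] (hΔ : ¬ ((p : ℤ) ∣ e.Δ)) {n : ℕ}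
    (hcard : Nat.card ((e.map (Int.castRingHom (ZMod p))).toAffine.Point) = n)
    (hap : ¬ ((p : ℤ) ∣ (p : ℤ) + 1 - n)) : IsOrdinaryAt (e.baseChange ℚ) p := by
  refine ⟨hasGoodReductionAtPrime_baseChange_int _ p hΔ, ?_⟩
  rw [frobeniusTrace_baseChange_int _ hcard]
  exact hap

end AtlasGeneric

end Summit.BirchSwinnertonDyer.BirchSwinnertonDyer.Rank2Observatory

end
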